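import Summits.QuantumFields.YangMills.Theorems.SmallCircleAnchorAnchorGapBBFPeelingAnalyticAux
import Literature.Probability.LatticeModels.BattleFederbushExpansion
import Mathlib.Analysis.Calculus.Deriv.Prod
import Mathlib.MeasureTheory.Measure.Lebesgue.Basic
import HarnessLib

/-!
# Crux `AnchorGap` (stmt-QuantumFields-11141), line `registered` — STUB PEEL: the Battle–Brydges–Federbush peeling formula, ANALYTIC form

The tree holds the peeling formula for POLYNOMIALS in the pair variables
(`Literature.Probability.LatticeModels.BattleFederbush.Script.eval_one_eq_sum_term`, formal cube integral; Mastropietro 2008 §2.8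
(2.91)–(2.98)).  The Gaussian cluster expansion needs it for a SMOOTH function `f` of the pair variables `s : Sym2 ι → ℝ` defined near the
interpolation points.  This file proves the registered stub `stub_bbfPeelingAnalytic` of the skeleton of record (crux workfile
`Cruxes/AnchorGap/Lines/birth.lean` :168, skeleton 9092be15): if `f` is `C^∞` on an open `U` containing every full interpolation point `ρ_s(t)`
(`Script.fullPt`, evaluated at real `t ∈ [0,1]^ι`) of every valid script, then

  `f(1) = Σ_{k < |ι|} Σ_{s valid} ∫_{[0,1]^ι} w_s(t) · (∂_{ℓ_k} ⋯ ∂_{ℓ_1} f)(σ_s(t)) dt`,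

the iterated directional derivatives being taken along the lines of the script in order (`List.foldl` over `s.lines`, first line
innermost) and `σ_s` the decoupled point (`Script.decPt`).  PROOF = the algebraic one (`liveTerm_eq`, `sum_liveTerm_succ`, `eval_one_eq_partial`)
with the real fundamental theorem of calculus in the newest parameter `t_{y_k}` inside the cube integral (the coordinate `t_{y_k}` is integrated
out by ✓`BBFPeel.setIntegral_unitCube_eq_integral_update`), the chain rule along the polynomial curve `θ ↦ ρ_s(t[y_k := θ])`
(✓`BBFPeel.hasDerivAt_eval_update` + `hasDerivAt_pi` + ✓`BBFPeel.clm_apply_eq_sum_single`), and the combinatorial identity ✓`Script.sum_cross_eq`.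
* §1 pointwise identities at real parameters: `π_s(t) = ρ_s(t[v := 1])`, `σ_s(t) = ρ_s(t[v := 0])`, `π_s`, `w_s` do not involve `t_v`
  (`v = y_k`), `∂_θ ρ_s(t[v := θ])_ℓ = 𝟙[ℓ ∼ ∂X_{k+1}]·π_s(t)_ℓ`; the unit cube (lit `unitCube`: compact, volume one) is stable under `t ↦ t[v := θ]`, `θ ∈ [0,1]`.
* §2 the chain rule `∂_θ H(ρ_s(t[v := θ])) = Σ_{ℓ ∼ ∂X_{k+1}} π_s(t)_ℓ · (∂_ℓ H)(ρ_s(t[v := θ]))`.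
* §3 ★ `live_eq_dec_add_sum` — ONE INTERPOLATION STEP for smooth `f` (the analytic `liveTerm_eq`).
* §4 `sum_script_succ` (regrouping the scripts of the next length), ★ `eq_partial` (the telescoped expansion after `n` steps), ★★★ `stub_bbfPeelingAnalytic`.
Also useful to the 20520 lane of cell `ym3-torus` (crux `FluctuationComparisonRegPrIntL`, LINE g19-2 REP∕GAS: the small-field cluster-expansion engine; LOCATE-REP px20 g15).

HONEST SCOPE.  [folklore] real analysis over the tree's script vocabulary; definition-free; nothing probabilistic or gauge-theoretic is asserted; the crux
`AnchorGap` (11141), GREP `stub_gaussianBBFPolymerRep`, SMOOTH, and every summit statement are NOT proved by this file.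

References: V. Mastropietro, *Non-Perturbative Renormalization* (World Scientific 2008) §2.8 (2.83)–(2.98) [Mastropietro2008]; G. A. Battle, P. Federbush,
Lett. Math. Phys. 8 (1984) 55–57 [BattleFederbush1984]; D. C. Brydges, *A short course on cluster expansions*, Les Houches 1984 [Brydges1986].
-/

set_option autoImplicit false

noncomputable section

namespace Summit.QuantumFields.YangMills.Theorems.AnchorGap

namespace BBFPeel

open MeasureTheory MvPolynomial Literature.Probability.LatticeModels Literature.Probability.LatticeModels.BattleFederbush
open Literature.MeasureTheory.Integral Literature.RingTheory.MvPolynomial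

/-! ### §1 Pointwise identities at real parameters; the unit cube -/

section Pointwise

variable {ι : Type*} [Fintype ι] [DecidableEq ι] {root : ι} {k : ℕ}

/-- `π_s(t) = ρ_s(t[y_k := 1])`. [folklore] -/
theorem eval_livePt_eq_update_one (s : Script root k) (hs : s.Valid) (t : ι → ℝ) (ℓ : Sym2 ι) :
    eval t (Script.livePt ℝ s ℓ) = eval (Function.update t (s.y (Fin.last k)) 1) (Script.fullPt ℝ s ℓ) := by
  rw [← eval_substAt, Script.substAt_one_fullPt s hs]

/-- `σ_s(t) = ρ_s(t[y_k := 0])`. [folklore] -/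
theorem eval_decPt_eq_update_zero (s : Script root k) (hs : s.Valid) (t : ι → ℝ) (ℓ : Sym2 ι) :
    eval t (Script.decPt ℝ s ℓ) = eval (Function.update t (s.y (Fin.last k)) 0) (Script.fullPt ℝ s ℓ) := by
  rw [← eval_substAt, Script.substAt_zero_fullPt s hs]

/-- `π_s` does not involve `t_{y_k}`. [folklore] -/
theorem eval_update_livePt (s : Script root k) (hs : s.Valid) (t : ι → ℝ) (θ : ℝ) (ℓ : Sym2 ι) :
    eval (Function.update t (s.y (Fin.last k)) θ) (Script.livePt ℝ s ℓ) = eval t (Script.livePt ℝ s ℓ) := by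
  rw [← eval_substAt, Script.livePt, substAt_monomial_of_eq_zero _ _ (Script.cutExp_apply_last s hs ℓ)]

/-- `w_s` does not involve `t_{y_k}`. [folklore] -/
theorem eval_update_weight (s : Script root k) (hs : s.Valid) (t : ι → ℝ) (θ : ℝ) :
    eval (Function.update t (s.y (Fin.last k)) θ) (Script.weight ℝ s) = eval t (Script.weight ℝ s) := by
  rw [← eval_substAt, Script.weight, substAt_monomial_of_eq_zero _ _ (Script.wExp_apply_last s hs)]

/-- `∂_θ ρ_s(t[y_k := θ])_ℓ = 𝟙[ℓ ∼ ∂X_{k+1}] · π_s(t)_ℓ`. [folklore] -/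
theorem hasDerivAt_eval_fullPt_update (s : Script root k) (hs : s.Valid) (t : ι → ℝ) (θ : ℝ) (ℓ : Sym2 ι) :
    HasDerivAt (fun τ : ℝ => eval (Function.update t (s.y (Fin.last k)) τ) (Script.fullPt ℝ s ℓ))
      (if crossB (s.pre k) ℓ = true then eval t (Script.livePt ℝ s ℓ) else 0) θ := by
  have h := hasDerivAt_eval_update (Script.fullPt ℝ s ℓ) t (s.y (Fin.last k)) θ
  rw [Script.pderiv_fullPt s hs] at h
  by_cases hc : crossB (s.pre k) ℓ = true
  · rw [if_pos hc] at h ⊢; rwa [eval_update_livePt s hs] at h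
  · rw [if_neg hc] at h ⊢; rwa [map_zero] at h

/-- The curve `θ ↦ ρ_s(t[y_k := θ])` in `ℝ^{Sym2 ι}` and its velocity. [folklore] -/
theorem hasDerivAt_fullPt_curve (s : Script root k) (hs : s.Valid) (t : ι → ℝ) (θ : ℝ) :
    HasDerivAt (fun τ : ℝ => fun ℓ : Sym2 ι => eval (Function.update t (s.y (Fin.last k)) τ) (Script.fullPt ℝ s ℓ))
      (fun ℓ : Sym2 ι => if crossB (s.pre k) ℓ = true then eval t (Script.livePt ℝ s ℓ) else 0) θ :=
  hasDerivAt_pi.2 fun ℓ => hasDerivAt_eval_fullPt_update s hs t θ ℓ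

omit [Fintype ι] [DecidableEq ι] in
/-- The unit cube is stable under resetting one coordinate inside `[0,1]`. [folklore] -/
theorem update_mem_unitCube {t : ι → ℝ} (ht : t ∈ unitCube ι) (v : ι) {θ : ℝ} (hθ : θ ∈ Set.Icc (0 : ℝ) 1)
    [DecidableEq ι] : Function.update t v θ ∈ unitCube ι := by
  rw [mem_unitCube] at ht ⊢
  intro i
  by_cases hi : i = v
  · subst hi; rwa [Function.update_self]
  · rw [Function.update_of_ne hi]; exact ht i

omit [DecidableEq ι] in
/-- The unit cube has volume one (lit ✓`volume_unitCube`): `∫_{[0,1]^ι} c = c`. [folklore] -/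
theorem setIntegral_unitCube_const (c : ℝ) : ∫ _t in unitCube ι, c = c := by
  rw [setIntegral_const, smul_eq_mul, measureReal_def, volume_unitCube, ENNReal.toReal_one, one_mul]

end Pointwise

/-! ### §2 The chain rule along the interpolation curve -/

section Chain

variable {ι : Type*} [Fintype ι] [DecidableEq ι] {root : ι} {k : ℕ}

/-- **Chain rule**: for `H` differentiable at `ρ_s(t[y_k := θ])`,
`∂_θ H(ρ_s(t[y_k := θ])) = Σ_ℓ 𝟙[ℓ ∼ ∂X_{k+1}] · π_s(t)_ℓ · (∂_ℓ H)(ρ_s(t[y_k := θ]))`. [folklore] -/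
theorem hasDerivAt_comp_fullPt_curve (s : Script root k) (hs : s.Valid) (t : ι → ℝ) (θ : ℝ) {H : (Sym2 ι → ℝ) → ℝ}
    (hH : DifferentiableAt ℝ H (fun ℓ : Sym2 ι => eval (Function.update t (s.y (Fin.last k)) θ) (Script.fullPt ℝ s ℓ))) :
    HasDerivAt (fun τ : ℝ => H (fun ℓ : Sym2 ι => eval (Function.update t (s.y (Fin.last k)) τ) (Script.fullPt ℝ s ℓ)))
      (∑ ℓ : Sym2 ι, if crossB (s.pre k) ℓ = true then eval t (Script.livePt ℝ s ℓ) *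
        fderiv ℝ H (fun ℓ' : Sym2 ι => eval (Function.update t (s.y (Fin.last k)) θ) (Script.fullPt ℝ s ℓ')) (Pi.single ℓ 1) else 0) θ := by
  have h := hH.hasFDerivAt.comp_hasDerivAt θ (hasDerivAt_fullPt_curve s hs t θ)
  rw [clm_apply_eq_sum_single] at h
  refine h.congr_deriv (Finset.sum_congr rfl fun ℓ _ => ?_)
  split_ifs <;> simp

end Chain

/-! ### §3 One interpolation step for a smooth function (the analytic `liveTerm_eq`) -/

section Step

variable {ι : Type*} [Fintype ι] [DecidableEq ι] {root : ι} {k : ℕ}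

omit [Fintype ι] [DecidableEq ι] in
/-- Continuity of `t ↦ G(P(t))` on the cube for `G` continuous on `U` and a polynomial point map `P` sending the cube into `U`. [folklore] -/
theorem continuousOn_comp_eval {U : Set (Sym2 ι → ℝ)} {G : (Sym2 ι → ℝ) → ℝ} (hG : ContinuousOn G U)
    (P : Sym2 ι → MvPolynomial ι ℝ) {S : Set (ι → ℝ)} (hS : ∀ t ∈ S, (fun ℓ : Sym2 ι => eval t (P ℓ)) ∈ U) :
    ContinuousOn (fun t : ι → ℝ => G (fun ℓ : Sym2 ι => eval t (P ℓ))) S :=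
  hG.comp (continuous_pi fun ℓ => MvPolynomial.continuous_eval (P ℓ)).continuousOn hS

/-- ★ **ONE INTERPOLATION STEP** (Mastropietro 2008, (2.85)∕(2.88), analytic form): for a valid script `s` whose full interpolation points over the
cube lie in an open `U` and `G` smooth on `U`,
`∫ w_s G(π_s) = ∫ w_s G(σ_s) + Σ_{j, z ∉ s} ∫ w_{s′} (∂_{ℓ′} G)(π_{s′})`, `s′ = s.snoc j z`, `ℓ′ = {y_j, z}` — write `π_s = ρ_s|_{t_v=1}`, `σ_s = ρ_s|_{t_v=0}`
for the newest parameter `t_v = t_{y_k}`, apply the real fundamental theorem of calculus in `t_v` (the weight does not involve `t_v`), the chain rule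
(`∂_{t_v} ρ_s(ℓ) ≠ 0` only for the pairs crossing the point set), integrate `t_v` back into the cube, and regroup the crossing pairs as (old point, new point).
[cite: Mastropietro2008, §2.8 (2.85)-(2.89)] -/
theorem live_eq_dec_add_sum (s : Script root k) (hs : s.Valid) {U : Set (Sym2 ι → ℝ)} (hU : IsOpen U)
    (hsU : ∀ t ∈ unitCube ι, (fun ℓ : Sym2 ι => eval t (Script.fullPt ℝ s ℓ)) ∈ U)
    {G : (Sym2 ι → ℝ) → ℝ} (hG : ContDiffOn ℝ (⊤ : ℕ∞) G U) :
    ∫ t in unitCube ι, eval t (Script.weight ℝ s) * G (fun ℓ : Sym2 ι => eval t (Script.livePt ℝ s ℓ)) =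
      (∫ t in unitCube ι, eval t (Script.weight ℝ s) * G (fun ℓ : Sym2 ι => eval t (Script.decPt ℝ s ℓ))) +
      ∑ j : Fin (k + 1), ∑ z ∈ (Finset.univ.image s.y)ᶜ,
        ∫ t in unitCube ι, eval t (Script.weight ℝ (Script.snoc s j z)) *
          (fun x : Sym2 ι → ℝ => fderiv ℝ G x (Pi.single s(s.y j, z) 1))
            (fun ℓ : Sym2 ι => eval t (Script.livePt ℝ (Script.snoc s j z) ℓ)) := by
  have hmeas : MeasurableSet (unitCube ι) := MeasurableSet.univ_pi fun _ => measurableSet_Icc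
  -- membership of the interpolation points in `U`
  have hρU : ∀ t ∈ unitCube ι, ∀ θ ∈ Set.Icc (0 : ℝ) 1,
      (fun ℓ : Sym2 ι => eval (Function.update t (s.y (Fin.last k)) θ) (Script.fullPt ℝ s ℓ)) ∈ U :=
    fun t ht θ hθ => hsU _ (update_mem_unitCube ht (s.y (Fin.last k)) hθ)
  have hπU : ∀ t ∈ unitCube ι, (fun ℓ : Sym2 ι => eval t (Script.livePt ℝ s ℓ)) ∈ U := by
    intro t ht
    have h := hρU t ht 1 ⟨zero_le_one, le_rfl⟩
    convert h using 1; funext ℓ; exact eval_livePt_eq_update_one s hs t ℓ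
  have hσU : ∀ t ∈ unitCube ι, (fun ℓ : Sym2 ι => eval t (Script.decPt ℝ s ℓ)) ∈ U := by
    intro t ht
    have h := hρU t ht 0 ⟨le_rfl, zero_le_one⟩
    convert h using 1; funext ℓ; exact eval_decPt_eq_update_zero s hs t ℓ
  have hGc : ContinuousOn G U := hG.continuousOn
  have hGd : ∀ x ∈ U, DifferentiableAt ℝ G x := fun x hx =>
    (hG.differentiableOn (by simp)).differentiableAt (hU.mem_nhds hx)
  have hdGc : ∀ ℓ : Sym2 ι, ContinuousOn (fun x : Sym2 ι → ℝ => fderiv ℝ G x (Pi.single ℓ 1)) U :=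
    fun ℓ => (contDiffOn_dirDeriv hU hG ℓ).continuousOn
  -- integrability of the three cube integrands (continuous on the compact cube)
  have hwc : Continuous fun t : ι → ℝ => eval t (Script.weight ℝ s) := MvPolynomial.continuous_eval _
  have hIlive : IntegrableOn (fun t : ι → ℝ => eval t (Script.weight ℝ s) * G (fun ℓ : Sym2 ι => eval t (Script.livePt ℝ s ℓ)))
      (unitCube ι) volume :=
    (hwc.continuousOn.mul (continuousOn_comp_eval hGc _ hπU)).integrableOn_compact isCompact_unitCube
  have hIdec : IntegrableOn (fun t : ι → ℝ => eval t (Script.weight ℝ s) * G (fun ℓ : Sym2 ι => eval t (Script.decPt ℝ s ℓ)))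
      (unitCube ι) volume :=
    (hwc.continuousOn.mul (continuousOn_comp_eval hGc _ hσU)).integrableOn_compact isCompact_unitCube
  -- the integrand after the chain rule, with `t_v` restored
  set Ψ : (ι → ℝ) → ℝ := fun t => eval t (Script.weight ℝ s) *
      ∑ ℓ : Sym2 ι, (if crossB (s.pre k) ℓ = true then eval t (Script.livePt ℝ s ℓ) *
        fderiv ℝ G (fun ℓ' : Sym2 ι => eval t (Script.fullPt ℝ s ℓ')) (Pi.single ℓ 1) else 0) with hΨ
  have hΨc : ContinuousOn Ψ (unitCube ι) := by
    refine hwc.continuousOn.mul (continuousOn_finsetSum _ fun ℓ _ => ?_)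
    by_cases hc : crossB (s.pre k) ℓ = true
    · simp only [hc, if_true]
      exact (MvPolynomial.continuous_eval _).continuousOn.mul (continuousOn_comp_eval (hdGc ℓ) _ hsU)
    · simp only [hc]
      exact continuousOn_const
  have hIΨ : IntegrableOn Ψ (unitCube ι) volume := hΨc.integrableOn_compact isCompact_unitCube
  -- Step 1: pointwise in `t`, the fundamental theorem of calculus in `t_v` and the chain rule
  have hstep : ∀ t ∈ unitCube ι,
      eval t (Script.weight ℝ s) * G (fun ℓ : Sym2 ι => eval t (Script.livePt ℝ s ℓ)) -
        eval t (Script.weight ℝ s) * G (fun ℓ : Sym2 ι => eval t (Script.decPt ℝ s ℓ)) =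
      ∫ θ in (0 : ℝ)..1, Ψ (Function.update t (s.y (Fin.last k)) θ) := by
    intro t ht
    -- the curve and its composition with `G`
    have hderiv : ∀ θ ∈ Set.uIcc (0 : ℝ) 1, HasDerivAt
        (fun τ : ℝ => G (fun ℓ : Sym2 ι => eval (Function.update t (s.y (Fin.last k)) τ) (Script.fullPt ℝ s ℓ)))
        (∑ ℓ : Sym2 ι, if crossB (s.pre k) ℓ = true then eval t (Script.livePt ℝ s ℓ) *
          fderiv ℝ G (fun ℓ' : Sym2 ι => eval (Function.update t (s.y (Fin.last k)) θ) (Script.fullPt ℝ s ℓ')) (Pi.single ℓ 1) else 0) θ := by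
      intro θ hθ
      rw [Set.uIcc_of_le zero_le_one] at hθ
      exact hasDerivAt_comp_fullPt_curve s hs t θ (hGd _ (hρU t ht θ hθ))
    have hcont : ContinuousOn (fun θ : ℝ => ∑ ℓ : Sym2 ι, if crossB (s.pre k) ℓ = true then eval t (Script.livePt ℝ s ℓ) *
          fderiv ℝ G (fun ℓ' : Sym2 ι => eval (Function.update t (s.y (Fin.last k)) θ) (Script.fullPt ℝ s ℓ')) (Pi.single ℓ 1) else 0)
        (Set.uIcc (0 : ℝ) 1) := by
      rw [Set.uIcc_of_le zero_le_one]
      refine continuousOn_finsetSum _ fun ℓ _ => ?_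
      by_cases hc : crossB (s.pre k) ℓ = true
      · simp only [hc, if_true]
        refine continuousOn_const.mul ?_
        refine (hdGc ℓ).comp (continuous_pi fun ℓ' => ?_).continuousOn fun θ hθ => hρU t ht θ hθ
        exact (MvPolynomial.continuous_eval _).comp (continuous_const.update (s.y (Fin.last k)) continuous_id)
      · simp only [hc]
        exact continuousOn_const
    have hFTC := intervalIntegral.integral_eq_sub_of_hasDerivAt hderiv hcont.intervalIntegrable
    -- rewrite the two endpoint values and the integrand
    have h1 : G (fun ℓ : Sym2 ι => eval (Function.update t (s.y (Fin.last k)) 1) (Script.fullPt ℝ s ℓ)) =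
        G (fun ℓ : Sym2 ι => eval t (Script.livePt ℝ s ℓ)) := by
      congr 1; funext ℓ; exact (eval_livePt_eq_update_one s hs t ℓ).symm
    have h0 : G (fun ℓ : Sym2 ι => eval (Function.update t (s.y (Fin.last k)) 0) (Script.fullPt ℝ s ℓ)) =
        G (fun ℓ : Sym2 ι => eval t (Script.decPt ℝ s ℓ)) := by
      congr 1; funext ℓ; exact (eval_decPt_eq_update_zero s hs t ℓ).symm
    have hΨt : ∀ θ : ℝ, Ψ (Function.update t (s.y (Fin.last k)) θ) = eval t (Script.weight ℝ s) *
        ∑ ℓ : Sym2 ι, (if crossB (s.pre k) ℓ = true then eval t (Script.livePt ℝ s ℓ) *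
          fderiv ℝ G (fun ℓ' : Sym2 ι => eval (Function.update t (s.y (Fin.last k)) θ) (Script.fullPt ℝ s ℓ')) (Pi.single ℓ 1) else 0) := by
      intro θ
      simp only [hΨ, eval_update_weight s hs, eval_update_livePt s hs]
    simp_rw [hΨt]
    rw [intervalIntegral.integral_const_mul, hFTC, h1, h0, mul_sub]
  -- Step 2: integrate over the cube and restore `t_v`
  rw [← sub_eq_iff_eq_add', ← integral_sub hIlive hIdec,
    setIntegral_congr_fun hmeas (fun t ht => hstep t ht),
    ← setIntegral_unitCube_eq_integral_update Ψ hIΨ (s.y (Fin.last k))]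
  -- Step 3: distribute and regroup the crossing pairs
  have hΨsum : ∀ t, Ψ t = ∑ ℓ : Sym2 ι, (if crossB (Finset.univ.image s.y) ℓ = true then
      eval t (Script.weight ℝ s) * eval t (Script.livePt ℝ s ℓ) *
        fderiv ℝ G (fun ℓ' : Sym2 ι => eval t (Script.fullPt ℝ s ℓ')) (Pi.single ℓ 1) else 0) := by
    intro t
    simp only [hΨ, Finset.mul_sum]
    rw [← Script.pre_eq_image s le_rfl]
    refine Finset.sum_congr rfl fun ℓ _ => ?_
    split_ifs <;> ring
  simp_rw [hΨsum]
  rw [integral_finsetSum _ (fun ℓ _ => ?_)]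
  · have hite : ∀ ℓ : Sym2 ι, (∫ t in unitCube ι, (if crossB (Finset.univ.image s.y) ℓ = true then
        eval t (Script.weight ℝ s) * eval t (Script.livePt ℝ s ℓ) *
          fderiv ℝ G (fun ℓ' : Sym2 ι => eval t (Script.fullPt ℝ s ℓ')) (Pi.single ℓ 1) else 0)) =
        if crossB (Finset.univ.image s.y) ℓ = true then ∫ t in unitCube ι,
          eval t (Script.weight ℝ s) * eval t (Script.livePt ℝ s ℓ) *
            fderiv ℝ G (fun ℓ' : Sym2 ι => eval t (Script.fullPt ℝ s ℓ')) (Pi.single ℓ 1) else 0 := by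
      intro ℓ; split_ifs <;> simp
    simp_rw [hite]
    rw [Script.sum_cross_eq s hs]
    refine Finset.sum_congr rfl fun j _ => Finset.sum_congr rfl fun z _ => ?_
    refine setIntegral_congr_fun hmeas fun t _ => ?_
    simp only [Script.weight_snoc, Script.livePt_snoc, map_mul]
  · -- integrability of each summand
    by_cases hc : crossB (Finset.univ.image s.y) ℓ = true
    · simp only [hc, if_true]
      exact (((hwc.mul (MvPolynomial.continuous_eval _)).continuousOn).mul
        (continuousOn_comp_eval (hdGc ℓ) _ hsU)).integrableOn_compact isCompact_unitCube
    · simp only [hc]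
      exact integrableOn_zero

end Step

/-! ### §4 Regrouping the scripts, the telescoped expansion, and the registered stub -/

section Assembly

variable {ι : Type*} [Fintype ι] [DecidableEq ι] {root : ι}

omit [DecidableEq ι] in
/-- Summing over the scripts of the next length = summing, over the valid scripts `s`, the parent index `j` and the new point `z ∉ s` (generic
summand; the analytic twin of `Script.sum_liveTerm_succ`). [folklore] -/
theorem sum_script_succ {M : Type*} [AddCommMonoid M] [DecidableEq ι] (k : ℕ) (Φ : Script root (k + 1) → M) :
    ∑ s : Script root (k + 1), (if s.Valid then Φ s else 0) =
      ∑ s : Script root k, if s.Valid then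
        ∑ j : Fin (k + 1), ∑ z ∈ (Finset.univ.image s.y)ᶜ, Φ (Script.snoc s j z) else 0 := by
  rw [← (Script.snocEquiv root k).symm.sum_comp, Fintype.sum_prod_type]
  refine Finset.sum_congr rfl fun s _ => ?_
  rw [Fintype.sum_prod_type]
  simp only [Script.snocEquiv, Equiv.coe_fn_symm_mk]
  split_ifs with hs
  · refine Finset.sum_congr rfl fun j _ => ?_
    rw [← Finset.sum_filter]
    refine Finset.sum_congr ?_ fun z _ => rfl
    ext z
    simp [Script.valid_snoc_iff, hs]
  · refine Finset.sum_eq_zero fun j _ => Finset.sum_eq_zero fun z _ => ?_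
    rw [if_neg (fun h => hs ((Script.valid_snoc_iff s j z).1 h).1)]

omit [Fintype ι] [DecidableEq ι] in
/-- The lines of the extended script: the new line is appended. [folklore] -/
theorem lines_snoc {k : ℕ} (s : Script root k) (i : Fin (k + 1)) (z : ι) :
    (Script.snoc s i z).lines = s.lines ++ [s(s.y i, z)] := rfl

/-- ★ **The telescoped expansion after `n` steps** (analytic twin of `Script.eval_one_eq_partial`): for `f` smooth on an open `U` containing all full
interpolation points over the cube, `f(1) = Σ_{k<n} Σ_{s valid, |s| = k+1} ∫ w_s (∂^s f)(σ_s) + Σ_{s valid, |s| = n+1} ∫ w_s (∂^s f)(π_s)`.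
[cite: Mastropietro2008, §2.8 (2.85)-(2.91)] -/
theorem eq_partial {U : Set (Sym2 ι → ℝ)} (hU : IsOpen U)
    (hsU : ∀ (k : ℕ) (s : Script root k), s.Valid → ∀ t ∈ unitCube ι, (fun ℓ : Sym2 ι => eval t (Script.fullPt ℝ s ℓ)) ∈ U)
    (f : (Sym2 ι → ℝ) → ℝ) (hf : ContDiffOn ℝ (⊤ : ℕ∞) f U) (n : ℕ) :
    f (fun _ => 1) =
      (∑ k ∈ Finset.range n, ∑ s : Script root k, if s.Valid then
        ∫ t in unitCube ι, eval t (Script.weight ℝ s) *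
          (s.lines.foldl (fun (g : (Sym2 ι → ℝ) → ℝ) (ℓ : Sym2 ι) => fun x : Sym2 ι → ℝ => fderiv ℝ g x (Pi.single ℓ 1)) f)
            (fun ℓ : Sym2 ι => eval t (Script.decPt ℝ s ℓ)) else 0) +
      ∑ s : Script root n, if s.Valid then
        ∫ t in unitCube ι, eval t (Script.weight ℝ s) *
          (s.lines.foldl (fun (g : (Sym2 ι → ℝ) → ℝ) (ℓ : Sym2 ι) => fun x : Sym2 ι → ℝ => fderiv ℝ g x (Pi.single ℓ 1)) f)
            (fun ℓ : Sym2 ι => eval t (Script.livePt ℝ s ℓ)) else 0 := by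
  induction n with
  | zero =>
    rw [Finset.range_zero, Finset.sum_empty, zero_add, Fintype.sum_subsingleton _ (Script.nil : Script root 0),
      if_pos Script.valid_nil]
    have hw : ∀ t : ι → ℝ, eval t (Script.weight ℝ (Script.nil : Script root 0)) = 1 := fun t => by
      rw [Script.weight, show (Script.nil : Script root 0).wExp = 0 from rfl]; simp
    have hπ : ∀ (t : ι → ℝ) (ℓ : Sym2 ι), eval t (Script.livePt ℝ (Script.nil : Script root 0) ℓ) = 1 := fun t ℓ => by
      have h0 : (Script.nil : Script root 0).cutExp 0 ℓ = 0 := by simp [Script.cutExp]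
      rw [Script.livePt, h0]; simp
    simp only [hw, hπ, one_mul, Script.lines, List.foldl_nil]
    exact (setIntegral_unitCube_const _).symm
  | succ n ih =>
    rw [ih, Finset.sum_range_succ, add_assoc, add_left_cancel_iff, sum_script_succ, ← Finset.sum_add_distrib]
    refine Finset.sum_congr rfl fun s _ => ?_
    split_ifs with hs
    · rw [live_eq_dec_add_sum s hs hU (hsU n s hs) (contDiffOn_foldl_dirDeriv hU s.lines hf)]
      congr 1
      refine Finset.sum_congr rfl fun j _ => Finset.sum_congr rfl fun z _ => ?_
      rw [lines_snoc, foldl_dirDeriv_append_singleton]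
    · rw [add_zero]

end Assembly

end BBFPeel

/-! ### The registered stub -/

open MeasureTheory Literature.Probability.LatticeModels in
/-- ★★★ **STUB PEEL — THE BATTLE–BRYDGES–FEDERBUSH PEELING FORMULA, ANALYTIC FORM** (registered signature of `Cruxes/AnchorGap/Lines/birth.lean` :168, verbatim):
for `f` smooth on an open `U ⊆ ℝ^{Sym2 ι}` containing every full interpolation point `ρ_s(t)` (`t ∈ [0,1]^ι`) of every valid script,
`f(1) = Σ_{k < |ι|} Σ_{s valid} ∫_{[0,1]^ι} w_s(t) (∂_{ℓ_k} ⋯ ∂_{ℓ_1} f)(σ_s(t)) dt`.  Proof: `BBFPeel.eq_partial` at `n = |ι|`; scripts with `|ι| + 1`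
distinct points do not exist. [cite: Mastropietro2008, §2.8 (2.91)-(2.98)] -/
theorem stub_bbfPeelingAnalytic :
    ∀ (ι : Type) [Fintype ι] [DecidableEq ι] (root : ι) (U : Set (Sym2 ι → ℝ)), IsOpen U → (∀ (k : ℕ) (s : BattleFederbush.Script root k), s.Valid → ∀ t ∈ Literature.MeasureTheory.Integral.unitCube ι, (fun ℓ : Sym2 ι => MvPolynomial.eval t (BattleFederbush.Script.fullPt ℝ s ℓ)) ∈ U) → ∀ f : (Sym2 ι → ℝ) → ℝ, ContDiffOn ℝ (⊤ : ℕ∞) f U → f (fun _ => 1) = ∑ k ∈ Finset.range (Fintype.card ι), ∑ s : BattleFederbush.Script root k, if s.Valid then ∫ t in Literature.MeasureTheory.Integral.unitCube ι, MvPolynomial.eval t (BattleFederbush.Script.weight ℝ s) * (s.lines.foldl (fun (g : (Sym2 ι → ℝ) → ℝ) (ℓ : Sym2 ι) => fun x : Sym2 ι → ℝ => fderiv ℝ g x (Pi.single ℓ 1)) f) (fun ℓ : Sym2 ι => MvPolynomial.eval t (BattleFederbush.Script.decPt ℝ s ℓ)) else 0 := by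
  intro ι _ _ root U hU hsU f hf
  rw [BBFPeel.eq_partial hU hsU f hf (Fintype.card ι), add_eq_left]
  refine Finset.sum_eq_zero fun s _ => ?_
  rw [if_neg]
  intro hs
  have := Fintype.card_le_of_injective _ (BattleFederbush.Script.y_injective s hs)
  simp at this

end Summit.QuantumFields.YangMills.Theorems.AnchorGap

end
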